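import Summits.HodgeConjecture.HodgeConjecture.Cruxes.FormalLiftingFromClassLifting.Disproof

/-!
# Line `isogeny-weight-parity` — crux `FormalLiftingFromClassLifting` (stmt-HodgeConjecture-13825)

Route `PadicSemiregularLift`, item P1a. Crux-plan skeleton (planner
`planner-cruxplan-stmt-HodgeConjecture-13825-isogeny-weight-parit-0`, 2026-08-16) of the crux idea
`Ideas/isogeny-weight-parity.md` (ideator 1; triage r1-1/2/3: pass ×3, "strongest abelian-branch line";
merge partner `isogeny-eigenweight-splitting`).

## Shape

The crux (verbatim `Theses/PadicSemiregularLift.lean`, l. 336) is attacked through the standing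
disprover's PROVED reduction `Disproof.crux_of_oneK_twoK`: under the crux hypotheses it suffices to
produce, for every `𝒳`,
* (1_K) `IntegralCompatibleLift` — an INTEGRAL compatible lift of `[E₁]` from the rational pro-class, and
* (2_K) `KernelTowerSurjective` — every kernel class `t ∈ ker(K₀(X_{n+1}) → K₀(X_k))` is the restriction
  of a kernel class on `X_{n+2}`.

(1_K) is ONE stub (`stub_integralProLift`, shared with every other line of this crux). (2_K) is cut
along the crux's own disjunction `d ≤ 3 ∨ Ω¹_{𝒳/W} free` and, on the `Ω¹`-free branch, along
`𝒳(W) ≠ ∅ ∨ 𝒳(W) = ∅`: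

* `Ω¹` free, `W`-point (all anchors `E^{2n}/W(𝔽̄_p)` of the route): THE LEVER. `stub_groupLaw` makes `𝒳`
  a `W`-group scheme (an abelian scheme: Wang / Néron–Ogg–Shafarevich / Néron mapping property +
  purity); the inversion `ι = [-1]` then acts on the whole `p`-adic tower by functoriality of base change,
  and the two PARITY STUBS say: kernel classes are bounded `p`-torsion on which `[-1]^* = -1`
  (`stub_oddKernelClasses`: the `π₀`-pieces of relative `K`-theory have ODD Hodge weight `b + j`), while
  `[-1]^* t - t` always lifts to a kernel class one level up (`stub_evenObstructions`: the one-step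
  obstruction groups have EVEN Hodge weight, so `[-1]^* = +1` on obstructions and `∂([-1]^*t - t) = 0`).
  Since `p` is odd (`d + 6 < p`), `-2t = [-1]^*t - t` lifts and `p^N t = 0` give that `t` lifts: this is the
  kernel-checked PARITY CERTIFICATE `kernelTowerSurjective_of_parity` below (no `sorry`; it uses only
  `ι ≫ ι = 𝟙`, functoriality of `K₀` and Bézout for `2` and `p^N`).
* `d ≤ 3` (any `Ω¹`): `stub_lowDimKernelTower` — the PD-staircase in weights `1, 2` (Berthelot–Ogus Pic
  Bockstein, `H²(𝒳,𝒪)` tf; relative `K₂`/BEK Thm 54, `H³(𝒳,Ω¹)` tf); the determinant peels weight `1` off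
  as honest line bundles and on a threefold the obstruction side has no weight `≥ 3`, so NO Adams /
  strictness input is needed (finding of this plan; cf. triage "(A3) debt").
* `Ω¹` free, NO `W`-point (torsors under abelian schemes of `p`-power order over exotic perfect `k`, e.g.
  `k = 𝔽_p(t)^{perf}`; never at the anchors): `stub_torsorKernelTower` — finite Galois `k'/k` with a point,
  parity upstairs, graded pieces of the relative `K`-groups upstairs are CO-INDUCED `G`-modules (normal
  basis for `W(k')/W(k)`), hence `G`-acyclic, so by étale descent of relative `TC` (= relative `K`, DGM)
  `π_t K(X_m, X_1) = π_t K(X'_m, X'_1)^G` and `∂ = (∂')^G = 0`.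

## Disproof used (`Cruxes/FormalLiftingFromClassLifting/Disproof.lean`, cdisprove cycle 1, imported)

* `crux_of_oneK_twoK` is the glue (so `liftsFormally_of_integralStepClassLifting`,
  `integralStepClassLifting_of_compatibleLift_of_kernelTowerSurjective` are used as proved);
  `rechoice_needs_kernelTower` is honoured: (2_K) is supplied on every branch, never dropped.
* `_false_without_`-type analyses honoured: (⋆) (`not_cruxWithoutStar`) and the rational pro-class
  (`CruxWithoutRationalProLift`) are consumed inside `crux_of_oneK_twoK` / `stub_integralProLift`
  ("the line uses (⋆) in the glue and `RationalProLift` at `stub_integralProLift`");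
  `CruxWithoutTorsionFreeO`: `H²(𝒳,𝒪)[p] = 0` is used at `stub_lowDimKernelTower` (Pic Bockstein) and
  at `stub_integralProLift`; on the group-law branch it is automatic (Hodge cohomology of abelian schemes
  is free) — exactly the parity reading of the Godeaux–Serre witness (`Tor₁(H^{b+1}, W/p^c)` classes
  would sit on the kernel side with the wrong, even, parity).
* The disprover's cycle-2 lead (superspecial `E³`, `K₃(W_n,(p)) ≅ W_{2(n-1)}`): the classes in question
  have weight `3 + 0`, ODD — kernel side; the line predicts they LIFT (triage F3: the sheaf-level
  cokernel is real but (2_K) holds on total hypercohomology). No landed `Negative/` lemma exists for this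
  crux (checked 2026-08-16); `ledger negatives --problem HodgeConjecture`: 2 unrelated items.

## Device

Named `Prop`s (`GroupLaw`, `OddKernelClasses`, …) over tree declarations; the registered `stub_*`
theorems restate them verbatim and fully qualified (so a Theorems-side `propose --supports
stmt-HodgeConjecture-13825` proof can restate them textually without importing this file);
`Registered.stub_*` are the name-keyed aliases taken as hypotheses of `FormalLiftingFromClassLifting_of`
(the skeleton audit admits a hypothesis whose head's last name component is a declared stub; same device
as `Summits/ABC/ABC/Cruxes/MazurKaneLaw/Lines/critical-kloosterman-powerful-moduli.lean`).
-/

set_option linter.dupNamespace false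

namespace Summit.HodgeConjecture.HodgeConjecture.Cruxes.FormalLiftingFromClassLifting.IsogenyWeightParity

open CategoryTheory AlgebraicGeometry Limits
open Literature.AlgebraicGeometry
open Literature.AlgebraicGeometry.Motives Literature.AlgebraicGeometry.Motives.WittScheme
open Summit.HodgeConjecture.HodgeConjecture.Theses.PadicSemiregularLift
open Summit.HodgeConjecture.HodgeConjecture.Cruxes.FormalLiftingFromClassLifting.Disproof

noncomputable section

/-! ## Vocabulary (abbreviations only; every stub below is stated WITHOUT them) -/

section Vocabulary

variable {p : ℕ} [Fact p.Prime] {k : Type} [Field k] [CharP k p] (𝒳 : SchemeOver (WittVector p k))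

/-- `W(k)`-points (sections over `W`) of `𝒳`. -/
abbrev WPoint := specOver (WittVector p k) (WittVector p k) ⟶ 𝒳

/-- `Ω¹_{𝒳/W} ≅ 𝒪^d`: the second disjunct of the crux's torsion-freeness clause. -/
abbrev CotangentFree (d : ℕ) : Prop :=
  Nonempty (cotangentSheaf 𝒳 ≅ SheafOfModules.free (R := 𝒳.left.ringCatSheaf) (Fin d))

/-- The inversion `[-1]` of a `W`-group law on `𝒳`, base-changed to the `n`-th thickening
`X_n = 𝒳 ⊗ W/pⁿ` (functoriality of `baseChange`; `thickening 𝒳 n` is `(baseChange W W_n).obj 𝒳` by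
definition). -/
abbrev invThickening [GrpObj 𝒳] (n : ℕ) : (thickening 𝒳 n).left ⟶ (thickening 𝒳 n).left :=
  ((baseChange (WittVector p k) (wittQuot p k n)).map (GrpObj.inv (X := 𝒳))).left

/-- `t ∈ K₀(X_{n+1})` is a KERNEL CLASS: it dies on the special fibre `X_k`. -/
abbrev IsKernelClass (n : ℕ) (t : KTheory.KZero (thickening 𝒳 (n + 1)).left) : Prop :=
  KTheory.KZero.map (specialFibreToThickening 𝒳 n) t = 0

end Vocabulary

/-! ## The statements (named `Prop`s) -/

/-- **S1 · group law on the pointed `Ω¹`-free branch.** A smooth proper model `𝒳/W(k)` (geometrically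
integral smooth projective fibres) with free cotangent sheaf and a `W`-point carries a `W`-group-scheme
structure (it is an abelian scheme: the generic fibre is a char-0 smooth projective variety with trivial
tangent bundle and a point, hence an abelian variety — Wang 1954 / Borel–Remmert; it has good reduction
because it has a smooth proper model — smooth proper base change + Néron–Ogg–Shafarevich; and `𝒳` is
its Néron model — Néron mapping property, then van der Waerden purity: the exceptional locus of the
proper birational `𝒳 → N` would be a divisor inside the irreducible special fibre, which dominates `N_k`;
Bosch–Lütkebohmert–Raynaud 1.2/8, 7.4/5). -/
def GroupLaw : Prop :=
  ∀ (p : ℕ) [Fact p.Prime] (k : Type) [Field k] [CharP k p] [PerfectRing k p] (d : ℕ)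
    (𝒳 : SchemeOver (WittVector p k)), IsSmoothProperModel d 𝒳 → CotangentFree 𝒳 d →
    Nonempty (WPoint 𝒳) → Nonempty (GrpObj 𝒳)

/-- **S2 · kernel classes are ODD.** For a `W`-group law on a smooth proper model (`⇒` abelian scheme)
and `p > d + 6`: every kernel class `t ∈ ker(K₀(X_{n+1}) → K₀(X_k))` is killed by a power of `p` and
satisfies `[-1]^* t = -t`. Paper proof: `ker = im(π₀K(X_{n+1},X_1) → K₀)`; relative `K ≃` relative `TC`
(Dundas–Goodwillie–McCarthy, nilpotent ideal `(p)`), BMS2/AMMN motivic filtration with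
`gr^i = RΓ(𝒳̂, Fil^i_1/Fil^i_{n+1})[2i-1]` (AMMN Thm F(2), `i ≤ p-2`, no Frobenius in the relative term;
triage F1), so `π₀ gr^i = H^{2i-1}(Fil^i_1/Fil^i_{n+1}) = L_1/L_{n+1} ⊂ H^{2i-1}_dR(𝒳/W)/L_{n+1}` (lattice
lemma, triage F2; Hodge cohomology of an abelian scheme is free, BBM 2.5), on which `[-1]^* = (-1)^{2i-1}
= -1`; all AHSS differentials shift the `[-1]`-weight by an odd number and die (`p` odd), the filtration is
finite (`i ≤ d+1`, AMMN Thm G) with `W_{n+1}`-module graded pieces (bounded `p`-torsion), and an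
involution that is `-1` on the graded pieces of a finite stable filtration of a `p`-group, `p` odd, is
`-1`. Falsifiable shadow (triage r1-1): `L ↦ [L] - 1` is ADDITIVE on `ker(Pic X_{n+1} → Pic X_k)`. -/
def OddKernelClasses : Prop :=
  ∀ (p : ℕ) [Fact p.Prime] (k : Type) [Field k] [CharP k p] [PerfectRing k p] (d : ℕ)
    (𝒳 : SchemeOver (WittVector p k)) [GrpObj 𝒳], IsSmoothProperModel d 𝒳 → d + 6 < p →
    ∀ n : ℕ, ∃ N : ℕ, ∀ t : KTheory.KZero (thickening 𝒳 (n + 1)).left, IsKernelClass 𝒳 n t →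
      ((p : ℤ) ^ N) • t = 0 ∧ KTheory.KZero.map (invThickening 𝒳 (n + 1)) t = -t

/-- **S3 · obstructions are EVEN (hardest).** Same setting: for every kernel class `t` on `X_{n+1}`,
the class `[-1]^* t - t` is the restriction of a KERNEL class on `X_{n+2}`. Paper proof: the one-step
obstruction `∂ : π₀K(X_{n+1},X_1) → π₋₁K(X_{n+2},X_{n+1})` is `[-1]`-equivariant (naturality of the
cofibre sequence of the triple `X_1 ⊂ X_{n+1} ⊂ X_{n+2}` under the automorphism `[-1]` of the tower);
the target is finitely filtered with graded pieces `H^{2i}(Fil^i_{n+1}/Fil^i_{n+2})` — EVEN Hodge weight,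
`[-1]^* = +1` (same dictionary one stem down; on a `p`-group with such a filtration an involution that is
`+1` on graded pieces is `+1`) — so `∂([-1]^*x - x) = ([-1]^* - 1)∂x = 0` and `[-1]^*x - x` lifts to
`π₀K(X_{n+2},X_1)`, whose image in `K₀(X_{n+2})` consists of kernel classes. This is where the
Godeaux–Serre phenomenon would live (a `Tor₁(H^{b+1}(𝒳,Ω^j), W/p^c)` class has the wrong parity); it is
absent because abelian schemes have free Hodge cohomology. -/
def EvenObstructions : Prop :=
  ∀ (p : ℕ) [Fact p.Prime] (k : Type) [Field k] [CharP k p] [PerfectRing k p] (d : ℕ)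
    (𝒳 : SchemeOver (WittVector p k)) [GrpObj 𝒳], IsSmoothProperModel d 𝒳 → d + 6 < p →
    ∀ (n : ℕ) (t : KTheory.KZero (thickening 𝒳 (n + 1)).left), IsKernelClass 𝒳 n t →
      ∃ t' : KTheory.KZero (thickening 𝒳 (n + 2)).left, IsKernelClass 𝒳 (n + 1) t' ∧
        KTheory.KZero.map (thickeningMap 𝒳 (Nat.le_succ (n + 1))) t' =
          KTheory.KZero.map (invThickening 𝒳 (n + 1)) t - t

/-- **S4 · integral pro-lift (1_K), shared.** Under the crux hypotheses, a rational pro-class through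
`[E₁] ⊗ 1` upgrades to an INTEGRAL compatible family through `[E₁]` (`Disproof.RationalProLift →
Disproof.IntegralCompatibleLift`, stated expanded). Paper proof: `ContinuousKZeroRat = ℚ ⊗ lim K₀(X_n)`
(tree), so `M[E₁] + (torsion)` pro-lifts integrally; the pro-obstruction group
`π₋₁ lim_m K(X_m, X_1)` is `p`-torsion-free — `lim¹ = 0` by (2_K), graded pieces
`H^{2r}(𝒳, p(r)Ω^{<r})` torsion-free under torsion-free Hodge cohomology (BEK Rem 35(2), Claim 49 PRO,
`a < p-2`; coniveau salvage for `d ≤ 3`: only `H²(𝒪)`, `H³(Ω¹)` and permanence of line-bundle classes;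
on the group-law branch parity kills the differentials; torsor branch by co-descent) — so the obstruction
of `[E₁]`, killed by `M`, vanishes. -/
def IntegralProLift : Prop :=
  ∀ (p : ℕ) [Fact p.Prime] (k : Type) [Field k] [CharP k p] [PerfectRing k p] (d : ℕ)
    (𝒳 : SchemeOver (WittVector p k)), IsSmoothProperModel d 𝒳 → Crystalline.IsProjectiveOverRing 𝒳 →
    d + 6 < p →
    (∀ (b : ℕ) (x : structureSheafCohomology 𝒳.left b), (p : ℤ) • x = 0 → x = 0) →
    (∀ (b : ℕ) (x : hodgeCohomologyOne 𝒳 b), (p : ℤ) • x = 0 → x = 0) →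
    (d ≤ 3 ∨ CotangentFree 𝒳 d) →
    ∀ (E₁ : (specialFibre 𝒳).left.Modules) (hE₁ : IsFiniteLocallyFree E₁),
      RationalProLift 𝒳 E₁ hE₁ → IntegralCompatibleLift 𝒳 E₁ hE₁

/-- **S5 · (2_K) in relative dimension `≤ 3`** (the crux's first disjunct; shared with the PD-staircase
lines). Paper proof: weight 1 = line bundles: `det t ∈ ker(Pic X_{n+1} → Pic X_k)` lifts because the Pic
Bockstein `H¹(𝒪_{X_m}) → H²(𝒪_{X_1})` vanishes (`H²(𝒳,𝒪)` `p`-tf, Berthelot–Ogus), and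
`t - ([det t] - 1) ∈ Fil²`; on `Fil²` the boundary `∂` lands in `Fil² π₋₁K(X_{n+2},X_{n+1})`, which for
`d ≤ 3` equals its weight-2 graded piece (`H^{2i}` of a length-`i` complex of coherent sheaves on a
threefold vanishes for `i ≥ 3`), where it is the graded weight-2 Bockstein
`H³(Fil²_1/Fil²_{n+2}) ↠ H³(Fil²_1/Fil²_{n+1})`-defect, zero under `H³(𝒳,Ω¹)`, `H^b(𝒳,𝒪)` `p`-tf (triage
F2/F3b; BEK Thm 54 / van der Kallen–Bloch relative `K₂`); `d ≤ 2`: Disproof item 1. -/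
def LowDimKernelTower : Prop :=
  ∀ (p : ℕ) [Fact p.Prime] (k : Type) [Field k] [CharP k p] [PerfectRing k p] (d : ℕ)
    (𝒳 : SchemeOver (WittVector p k)), IsSmoothProperModel d 𝒳 → Crystalline.IsProjectiveOverRing 𝒳 →
    d + 6 < p →
    (∀ (b : ℕ) (x : structureSheafCohomology 𝒳.left b), (p : ℤ) • x = 0 → x = 0) →
    (∀ (b : ℕ) (x : hodgeCohomologyOne 𝒳 b), (p : ℤ) • x = 0 → x = 0) →
    d ≤ 3 → KernelTowerSurjective 𝒳

/-- **S6 · (2_K) for pointless parallelisable models** (the residual of the `Ω¹`-free branch: `𝒳(W) = ∅`,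
i.e. `X_k(k) = ∅` by Hensel; then `𝒳` is a torsor under an abelian scheme, possibly of `p`-power order,
so it has NO involution acting as `-1` on `H¹` — such torsors exist over `k = 𝔽_p(t)^{perf}`, never over
finite or algebraically closed `k`). Paper proof (Galois co-descent): `X_k` has a point over a finite
Galois `k'/k`, Hensel gives a `W(k')`-point of `𝒳' = 𝒳 ⊗ W(k')`, so S1–S3 apply to `𝒳'`: parity makes
the AHSS of `K(X'_m, X'_1)` degenerate, and its graded pieces are `(finite W-module) ⊗_W W(k')` with
`G = Gal(k'/k)` acting through `W(k') ≅ W(k)[G]` (normal basis; translations act trivially on Hodge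
cohomology by rigidity) — CO-INDUCED, hence `G`-acyclic; relative `K` = relative `TC` (DGM) is an étale
sheaf (Geisser–Hesselholt / BMS2 §3), so `K(X_m,X_1) ≃ K(X'_m,X'_1)^{hG}`, the HFPSS collapses to
`π_t K(X_m,X_1) = (π_t K(X'_m,X'_1))^G`, and `∂ = (∂')^G = 0`. (The norm trick of the idea card only
reaches torsors split by a prime-to-`p` extension.) -/
def TorsorKernelTower : Prop :=
  ∀ (p : ℕ) [Fact p.Prime] (k : Type) [Field k] [CharP k p] [PerfectRing k p] (d : ℕ)
    (𝒳 : SchemeOver (WittVector p k)), IsSmoothProperModel d 𝒳 → Crystalline.IsProjectiveOverRing 𝒳 →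
    d + 6 < p →
    (∀ (b : ℕ) (x : structureSheafCohomology 𝒳.left b), (p : ℤ) • x = 0 → x = 0) →
    (∀ (b : ℕ) (x : hodgeCohomologyOne 𝒳 b), (p : ℤ) • x = 0 → x = 0) →
    CotangentFree 𝒳 d → IsEmpty (WPoint 𝒳) → KernelTowerSurjective 𝒳

/-! ## The registered stubs (`sorry` lives only here; signatures verbatim, abbreviation-free, fully
qualified, so that a Theorems-side `propose --supports stmt-HodgeConjecture-13825` proof can restate them
textually) -/

/-- **STUB 1 · `stub_groupLaw`** (M) — `GroupLaw`: pointed smooth proper models with free cotangent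
sheaf are `W`-group schemes. Not provable in Lean at this pin (no abelian schemes / Néron models in
Mathlib); paper theorem (Wang; Serre–Tate NOS; BLR Néron Models 1.2/8, 1.3/2, 7.4). -/
theorem stub_groupLaw : ∀ (p : ℕ) [Fact p.Prime] (k : Type) [Field k] [CharP k p] [PerfectRing k p] (d : ℕ) (𝒳 : Literature.AlgebraicGeometry.Motives.SchemeOver (WittVector p k)), Literature.AlgebraicGeometry.Motives.WittScheme.IsSmoothProperModel d 𝒳 → Nonempty (Literature.AlgebraicGeometry.Motives.cotangentSheaf 𝒳 ≅ SheafOfModules.free (R := 𝒳.left.ringCatSheaf) (Fin d)) → Nonempty (Literature.AlgebraicGeometry.Motives.specOver (WittVector p k) (WittVector p k) ⟶ 𝒳) → Nonempty (CategoryTheory.GrpObj 𝒳) := by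
  sorry

/-- **STUB 2 · `stub_oddKernelClasses`** (L) — `OddKernelClasses`: for a `W`-group law on a smooth
proper model, `p > d + 6`, kernel classes of `K₀(X_{n+1}) → K₀(X_k)` are bounded `p`-torsion and
`[-1]^*`-ANTI-invariant. -/
theorem stub_oddKernelClasses : ∀ (p : ℕ) [Fact p.Prime] (k : Type) [Field k] [CharP k p] [PerfectRing k p] (d : ℕ) (𝒳 : Literature.AlgebraicGeometry.Motives.SchemeOver (WittVector p k)) [CategoryTheory.GrpObj 𝒳], Literature.AlgebraicGeometry.Motives.WittScheme.IsSmoothProperModel d 𝒳 → d + 6 < p → ∀ n : ℕ, ∃ N : ℕ, ∀ t : Literature.AlgebraicGeometry.KTheory.KZero (Literature.AlgebraicGeometry.Motives.WittScheme.thickening 𝒳 (n + 1)).left, Literature.AlgebraicGeometry.KTheory.KZero.map (Literature.AlgebraicGeometry.Motives.WittScheme.specialFibreToThickening 𝒳 n) t = 0 → ((p : ℤ) ^ N) • t = 0 ∧ Literature.AlgebraicGeometry.KTheory.KZero.map (Y := (Literature.AlgebraicGeometry.Motives.WittScheme.thickening 𝒳 (n + 1)).left) (Z := (Literature.AlgebraicGeometry.Motives.WittScheme.thickening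 𝒳 (n + 1)).left) ((Literature.AlgebraicGeometry.Motives.baseChange (WittVector p k) (Literature.AlgebraicGeometry.Motives.wittQuot p k (n + 1))).map (CategoryTheory.GrpObj.inv (X := 𝒳))).left t = -t := by
  sorry

/-- **STUB 3 · `stub_evenObstructions`** (L, HARDEST) — `EvenObstructions`: for a `W`-group law on a
smooth proper model, `p > d + 6`, and a kernel class `t` on `X_{n+1}`, the class `[-1]^* t - t` is the
restriction of a kernel class on `X_{n+2}`. -/
theorem stub_evenObstructions : ∀ (p : ℕ) [Fact p.Prime] (k : Type) [Field k] [CharP k p] [PerfectRing k p] (d : ℕ) (𝒳 : Literature.AlgebraicGeometry.Motives.SchemeOver (WittVector p k)) [CategoryTheory.GrpObj 𝒳], Literature.AlgebraicGeometry.Motives.WittScheme.IsSmoothProperModel d 𝒳 → d + 6 < p → ∀ (n : ℕ) (t : Literature.AlgebraicGeometry.KTheory.KZero (Literature.AlgebraicGeometry.Motives.WittScheme.thickening 𝒳 (n + 1)).left), Literature.AlgebraicGeometry.KTheory.KZero.map (Literature.AlgebraicGeometry.Motives.WittScheme.specialFibreToThickening 𝒳 n) t = 0 → ∃ t' : Literature.AlgebraicGeometry.KTheory.KZero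 (Literature.AlgebraicGeometry.Motives.WittScheme.thickening 𝒳 (n + 2)).left, Literature.AlgebraicGeometry.KTheory.KZero.map (Literature.AlgebraicGeometry.Motives.WittScheme.specialFibreToThickening 𝒳 (n + 1)) t' = 0 ∧ Literature.AlgebraicGeometry.KTheory.KZero.map (Literature.AlgebraicGeometry.Motives.WittScheme.thickeningMap 𝒳 (Nat.le_succ (n + 1))) t' = Literature.AlgebraicGeometry.KTheory.KZero.map (Y := (Literature.AlgebraicGeometry.Motives.WittScheme.thickening 𝒳 (n + 1)).left) (Z := (Literature.AlgebraicGeometry.Motives.WittScheme.thickening 𝒳 (n + 1)).left) ((Literature.AlgebraicGeometry.Motives.baseChange (WittVector p k) (Literature.AlgebraicGeometry.Motives.wittQuot p k (n + 1))).map (CategoryTheory.GrpObj.inv (X := 𝒳))).left t - t := by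
  sorry

/-- **STUB 4 · `stub_integralProLift`** (M, shared) — `IntegralProLift` = Disproof (1_K) under the crux
hypotheses: rational pro-class `⇒` integral compatible family. -/
theorem stub_integralProLift : ∀ (p : ℕ) [Fact p.Prime] (k : Type) [Field k] [CharP k p] [PerfectRing k p] (d : ℕ) (𝒳 : Literature.AlgebraicGeometry.Motives.SchemeOver (WittVector p k)), Literature.AlgebraicGeometry.Motives.WittScheme.IsSmoothProperModel d 𝒳 → Literature.AlgebraicGeometry.Crystalline.IsProjectiveOverRing 𝒳 → d + 6 < p → (∀ (b : ℕ) (x : Literature.AlgebraicGeometry.Motives.structureSheafCohomology 𝒳.left b), (p : ℤ) • x = 0 → x = 0) → (∀ (b : ℕ) (x : Literature.AlgebraicGeometry.Motives.hodgeCohomologyOne 𝒳 b), (p : ℤ) • x = 0 → x = 0) → (d ≤ 3 ∨ Nonempty (Literature.AlgebraicGeometry.Motives.cotangentSheaf 𝒳 ≅ SheafOfModules.free (R := 𝒳.left.ringCatSheaf) (Fin d))) → ∀ (E₁ : (Literature.AlgebraicGeometry.Motives.WittScheme.specialFibre 𝒳).left.Modules) (hE₁ : Literature.AlgebraicGeometry.Motives.IsFiniteLocallyFree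 E₁), (∃ ξ : Literature.AlgebraicGeometry.KTheory.ContinuousKZeroRat (Ideal.span {(p : WittVector p k)}) 𝒳, Literature.AlgebraicGeometry.KTheory.KZeroRat.map (Literature.AlgebraicGeometry.Crystalline.specialFibreToTower 𝒳) (Literature.AlgebraicGeometry.KTheory.ContinuousKZeroRat.specialFibre (Ideal.span {(p : WittVector p k)}) 𝒳 ξ) = Literature.AlgebraicGeometry.KTheory.KZeroRat.of E₁ hE₁) → ∃ x : ∀ n : ℕ, Literature.AlgebraicGeometry.KTheory.KZero (Literature.AlgebraicGeometry.Motives.WittScheme.thickening 𝒳 (n + 1)).left, (∀ n, Literature.AlgebraicGeometry.KTheory.KZero.map (Literature.AlgebraicGeometry.Motives.WittScheme.thickeningMap 𝒳 (Nat.le_succ (n + 1))) (x (n + 1)) = x n) ∧ Literature.AlgebraicGeometry.KTheory.KZero.map (Literature.AlgebraicGeometry.Motives.WittScheme.specialFibreToThickening 𝒳 0) (x 0) = Literature.AlgebraicGeometry.KTheory.KZero.of E₁ hE₁ := by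
  sorry

/-- **STUB 5 · `stub_lowDimKernelTower`** (L, shared with the PD-staircase lines) — `LowDimKernelTower`
= Disproof (2_K) for `d ≤ 3` under the crux hypotheses. -/
theorem stub_lowDimKernelTower : ∀ (p : ℕ) [Fact p.Prime] (k : Type) [Field k] [CharP k p] [PerfectRing k p] (d : ℕ) (𝒳 : Literature.AlgebraicGeometry.Motives.SchemeOver (WittVector p k)), Literature.AlgebraicGeometry.Motives.WittScheme.IsSmoothProperModel d 𝒳 → Literature.AlgebraicGeometry.Crystalline.IsProjectiveOverRing 𝒳 → d + 6 < p → (∀ (b : ℕ) (x : Literature.AlgebraicGeometry.Motives.structureSheafCohomology 𝒳.left b), (p : ℤ) • x = 0 → x = 0) → (∀ (b : ℕ) (x : Literature.AlgebraicGeometry.Motives.hodgeCohomologyOne 𝒳 b), (p : ℤ) • x = 0 → x = 0) → d ≤ 3 → ∀ (n : ℕ) (t : Literature.AlgebraicGeometry.KTheory.KZero (Literature.AlgebraicGeometry.Motives.WittScheme.thickening 𝒳 (n + 1)).left), Literature.AlgebraicGeometry.KTheory.KZero.map (Literature.AlgebraicGeometry.Motives.WittScheme.specialFibreToThickening 𝒳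 n) t = 0 → ∃ t' : Literature.AlgebraicGeometry.KTheory.KZero (Literature.AlgebraicGeometry.Motives.WittScheme.thickening 𝒳 (n + 2)).left, Literature.AlgebraicGeometry.KTheory.KZero.map (Literature.AlgebraicGeometry.Motives.WittScheme.specialFibreToThickening 𝒳 (n + 1)) t' = 0 ∧ Literature.AlgebraicGeometry.KTheory.KZero.map (Literature.AlgebraicGeometry.Motives.WittScheme.thickeningMap 𝒳 (Nat.le_succ (n + 1))) t' = t := by
  sorry

/-- **STUB 6 · `stub_torsorKernelTower`** (M–L) — `TorsorKernelTower` = Disproof (2_K) for `Ω¹`-free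
models WITHOUT a `W`-point (Galois co-descent from the pointed case). -/
theorem stub_torsorKernelTower : ∀ (p : ℕ) [Fact p.Prime] (k : Type) [Field k] [CharP k p] [PerfectRing k p] (d : ℕ) (𝒳 : Literature.AlgebraicGeometry.Motives.SchemeOver (WittVector p k)), Literature.AlgebraicGeometry.Motives.WittScheme.IsSmoothProperModel d 𝒳 → Literature.AlgebraicGeometry.Crystalline.IsProjectiveOverRing 𝒳 → d + 6 < p → (∀ (b : ℕ) (x : Literature.AlgebraicGeometry.Motives.structureSheafCohomology 𝒳.left b), (p : ℤ) • x = 0 → x = 0) → (∀ (b : ℕ) (x : Literature.AlgebraicGeometry.Motives.hodgeCohomologyOne 𝒳 b), (p : ℤ) • x = 0 → x = 0) → Nonempty (Literature.AlgebraicGeometry.Motives.cotangentSheaf 𝒳 ≅ SheafOfModules.free (R := 𝒳.left.ringCatSheaf) (Fin d)) → IsEmpty (Literature.AlgebraicGeometry.Motives.specOver (WittVector p k) (WittVector p k) ⟶ 𝒳) → ∀ (n : ℕ) (t : Literature.AlgebraicGeometry.KTheory.KZero (Literature.AlgebraicGeometry.Motives.WittScheme.thickening 𝒳 (n + 1)).left),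 Literature.AlgebraicGeometry.KTheory.KZero.map (Literature.AlgebraicGeometry.Motives.WittScheme.specialFibreToThickening 𝒳 n) t = 0 → ∃ t' : Literature.AlgebraicGeometry.KTheory.KZero (Literature.AlgebraicGeometry.Motives.WittScheme.thickening 𝒳 (n + 2)).left, Literature.AlgebraicGeometry.KTheory.KZero.map (Literature.AlgebraicGeometry.Motives.WittScheme.specialFibreToThickening 𝒳 (n + 1)) t' = 0 ∧ Literature.AlgebraicGeometry.KTheory.KZero.map (Literature.AlgebraicGeometry.Motives.WittScheme.thickeningMap 𝒳 (Nat.le_succ (n + 1))) t' = t := by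
  sorry

/-! ## Consistency: each named statement IS its registered stub (definitionally) -/

theorem groupLaw_holds : GroupLaw := stub_groupLaw
theorem oddKernelClasses_holds : OddKernelClasses := stub_oddKernelClasses
theorem evenObstructions_holds : EvenObstructions := stub_evenObstructions
theorem integralProLift_holds : IntegralProLift := stub_integralProLift
theorem lowDimKernelTower_holds : LowDimKernelTower := stub_lowDimKernelTower
theorem torsorKernelTower_holds : TorsorKernelTower := stub_torsorKernelTower

/-! ## Name-keyed aliases of the six statements (the hypotheses of the composition) -/
namespace Registered

/-- Alias of `GroupLaw` keyed by the registered stub name. -/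
abbrev stub_groupLaw : Prop := GroupLaw
/-- Alias of `OddKernelClasses` keyed by the registered stub name. -/
abbrev stub_oddKernelClasses : Prop := OddKernelClasses
/-- Alias of `EvenObstructions` keyed by the registered stub name. -/
abbrev stub_evenObstructions : Prop := EvenObstructions
/-- Alias of `IntegralProLift` keyed by the registered stub name. -/
abbrev stub_integralProLift : Prop := IntegralProLift
/-- Alias of `LowDimKernelTower` keyed by the registered stub name. -/
abbrev stub_lowDimKernelTower : Prop := LowDimKernelTower
/-- Alias of `TorsorKernelTower` keyed by the registered stub name. -/
abbrev stub_torsorKernelTower : Prop := TorsorKernelTower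

end Registered

/-! ## Proved glue: the parity certificate -/

/-- `2` and `p^N` are comaximal in `ℤ` when `p` is an odd prime. -/
theorem exists_bezout_two_primePow {p : ℕ} [Fact p.Prime] (hp2 : p ≠ 2) (N : ℕ) :
    ∃ u v : ℤ, u * 2 + v * (p : ℤ) ^ N = 1 := by
  have hcop : Nat.Coprime 2 (p ^ N) :=
    Nat.Coprime.pow_right N ((Nat.coprime_primes Nat.prime_two (Fact.out : p.Prime)).mpr (Ne.symm hp2))
  obtain ⟨u, v, huv⟩ := Nat.isCoprime_iff_coprime.mpr hcop
  exact ⟨u, v, by exact_mod_cast huv⟩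

section Parity

variable {p : ℕ} [Fact p.Prime] {k : Type} [Field k]

/-- `[-1] ∘ [-1] = id` on every thickening (functoriality of base change + `ι ≫ ι = 𝟙`). -/
theorem invThickening_comp_invThickening (𝒳 : SchemeOver (WittVector p k)) [GrpObj 𝒳] (n : ℕ) :
    invThickening 𝒳 n ≫ invThickening 𝒳 n = 𝟙 _ := by
  change ((baseChange (WittVector p k) (wittQuot p k n)).map (GrpObj.inv (X := 𝒳))).left ≫
      ((baseChange (WittVector p k) (wittQuot p k n)).map (GrpObj.inv (X := 𝒳))).left = _
  rw [← Over.comp_left, ← CategoryTheory.Functor.map_comp, GrpObj.inv_comp_inv, CategoryTheory.Functor.map_id]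
  all_goals exact rfl

/-- Hence `[-1]^*` is an involution of `K₀(X_n)`. -/
theorem map_invThickening_map_invThickening (𝒳 : SchemeOver (WittVector p k)) [GrpObj 𝒳] (n : ℕ)
    (x : KTheory.KZero (thickening 𝒳 n).left) :
    KTheory.KZero.map (invThickening 𝒳 n) (KTheory.KZero.map (invThickening 𝒳 n) x) = x := by
  rw [← KTheory.KZero.map_comp_apply, invThickening_comp_invThickening, KTheory.KZero.map_id]
  all_goals exact rfl

/-- **THE PARITY CERTIFICATE** (kernel-checked core of the line). On a `W`-group scheme with `p` odd:
if every kernel class `t` of level `n+1` is `p`-power torsion with `[-1]^*t = -t` (S2) and `[-1]^*t - t`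
lifts to a kernel class of level `n+2` (S3), then EVERY kernel class lifts to a kernel class — (2_K),
`Disproof.KernelTowerSurjective`. Proof: `[-1]^*t - t = -2t` lifts, `p^N t = 0`, and
`u·2 + v·p^N = 1`. (Only `ι ≫ ι = 𝟙` enters: `map_invThickening_map_invThickening` is recorded for the
lead but not even needed here.) -/
theorem kernelTowerSurjective_of_parity [CharP k p] (𝒳 : SchemeOver (WittVector p k)) [GrpObj 𝒳]
    (hp2 : p ≠ 2)
    (hodd : ∀ n : ℕ, ∃ N : ℕ, ∀ t : KTheory.KZero (thickening 𝒳 (n + 1)).left, IsKernelClass 𝒳 n t →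
      ((p : ℤ) ^ N) • t = 0 ∧ KTheory.KZero.map (invThickening 𝒳 (n + 1)) t = -t)
    (heven : ∀ (n : ℕ) (t : KTheory.KZero (thickening 𝒳 (n + 1)).left), IsKernelClass 𝒳 n t →
      ∃ t' : KTheory.KZero (thickening 𝒳 (n + 2)).left, IsKernelClass 𝒳 (n + 1) t' ∧
        KTheory.KZero.map (thickeningMap 𝒳 (Nat.le_succ (n + 1))) t' =
          KTheory.KZero.map (invThickening 𝒳 (n + 1)) t - t) :
    KernelTowerSurjective 𝒳 := by
  intro n t ht
  obtain ⟨N, hN⟩ := hodd n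
  obtain ⟨hpt, hinv⟩ := hN t ht
  obtain ⟨t', ht', hlift⟩ := heven n t ht
  obtain ⟨u, v, huv⟩ := exists_bezout_two_primePow hp2 N
  have ht'' : KTheory.KZero.map (specialFibreToThickening 𝒳 (n + 1)) t' = 0 := ht'
  -- `[-1]^* t - t = -(t + t)` lifts (as `t'`), so `t + t` lifts as `-t'`,
  have h2 : t + t = KTheory.KZero.map (thickeningMap 𝒳 (Nat.le_succ (n + 1))) (-t') := by
    rw [map_neg, hlift, hinv]
    abel
  -- and `t = u • (t + t) + v • (p^N • t)` by Bézout.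
  have key : u • (t + t) + v • (((p : ℤ) ^ N) • t) = t := by
    rw [smul_add, smul_smul, ← add_smul, ← add_smul, ← mul_two, huv, one_smul]
  refine ⟨-(u • t'), ?_, ?_⟩
  · show KTheory.KZero.map (specialFibreToThickening 𝒳 (n + 1)) (-(u • t')) = 0
    rw [map_neg, map_zsmul, ht'', smul_zero, neg_zero]
  · rw [map_neg, map_zsmul, ← key, hpt, smul_zero, add_zero, h2, map_neg, smul_neg]

end Parity

/-! ## The composition: the six stubs imply the crux, by name -/

/-- `FormalLiftingFromClassLifting` from the six stubs (no `sorry`): by `Disproof.crux_of_oneK_twoK` it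
suffices to give (1_K) — STUB 4 — and (2_K), which is STUB 5 when `d ≤ 3`, STUB 6 when `Ω¹` is free and
`𝒳` has no `W`-point, and otherwise the PARITY CERTIFICATE fed by STUB 1 (group law), STUB 2 (odd kernel
classes) and STUB 3 (even obstructions); `p ≠ 2` because `d + 6 < p`. -/
theorem FormalLiftingFromClassLifting_of (h₁ : Registered.stub_groupLaw)
    (h₂ : Registered.stub_oddKernelClasses) (h₃ : Registered.stub_evenObstructions)
    (h₄ : Registered.stub_integralProLift) (h₅ : Registered.stub_lowDimKernelTower)
    (h₆ : Registered.stub_torsorKernelTower) :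
    Summit.HodgeConjecture.HodgeConjecture.Theses.PadicSemiregularLift.FormalLiftingFromClassLifting := by
  refine crux_of_oneK_twoK fun p _ k _ _ _ d 𝒳 hX hproj hp hH E₁ hE₁ hr => ⟨?_, ?_⟩
  · exact h₄ p k d 𝒳 hX hproj hp hH.1 hH.2.1 hH.2.2 E₁ hE₁ hr
  · have hp2 : p ≠ 2 := by omega
    rcases hH.2.2 with hd | hfree
    · exact h₅ p k d 𝒳 hX hproj hp hH.1 hH.2.1 hd
    · rcases isEmpty_or_nonempty (WPoint 𝒳) with h0 | hpt
      · exact h₆ p k d 𝒳 hX hproj hp hH.1 hH.2.1 hfree h0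
      · obtain ⟨G⟩ := h₁ p k d 𝒳 hX hfree hpt
        letI : GrpObj 𝒳 := G
        exact kernelTowerSurjective_of_parity 𝒳 hp2 (h₂ p k d 𝒳 hX hp) (h₃ p k d 𝒳 hX hp)

/-- Wiring check: the registered stubs feed `FormalLiftingFromClassLifting_of` as stated. -/
example : Summit.HodgeConjecture.HodgeConjecture.Theses.PadicSemiregularLift.FormalLiftingFromClassLifting :=
  FormalLiftingFromClassLifting_of stub_groupLaw stub_oddKernelClasses stub_evenObstructions
    stub_integralProLift stub_lowDimKernelTower stub_torsorKernelTower

end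

end Summit.HodgeConjecture.HodgeConjecture.Cruxes.FormalLiftingFromClassLifting.IsogenyWeightParity
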